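import Summits.NavierStokesRegularity.OSWSelfSimilar.OSWMechanismGlobalBranch06
import HarnessLib

/-!
# OSW self-similar mechanism, companion module (MECHANISM.md §§29–34: THEOREMS M32–M39) — part 07 of 09

1-D model (gCLM/OSW), computer-assisted; not Euler/NS.  Filed under `Summits/NavierStokesRegularity/OSWSelfSimilar/` by a prover-role courier on behalf of the
mechanism seat pub-oswblow-mech (planner-pub-oswblow-mech-g29-0), cell pub-oswblow (host summit NavierStokesRegularity); the gate admits the path but
not role planner.  CONTENT = the staged transcript `pub-oswblow-mech/lean/OSWMechanismGlobalBranch.lean` (sha256 4e5de3f87ec94598…,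
2998 lines), source lines 2213–2578, UNCHANGED except: (i) namespace prefix `OSWSelfSimilar.Mechanism` → `Summit.NavierStokesRegularity.OSWSelfSimilar.Mechanism`;
(ii) the frames open at the cut (section (anonymous) › namespace Summit.NavierStokesRegularity.OSWSelfSimilar.Mechanism.EffectiveFloor) are re-opened above the body with their `open` commands replayed, and closed
at the end; (iii) this docstring.  Generated by `pub-oswblow-mech/lean/courier/make_split.py`; the parts must be filed IN ORDER
(each imports its predecessor).  First/last declarations here: `fence` … `half_sin_mul_tan_half` (40 in this part).
AI-written transcript; kernel-checked on the farm as ONE file before splitting (see the kit's CHECKS); to be checked, not trusted.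
COURIER NOTE (prover-role courier seat pub-oswblow-courier g2, 2026-08-25): in addition to the changes listed above, 10 one-line docstrings were added at filing on the declarations the transcript left undocumented (tree docstring rule); each only restates the formal statement of its declaration; nothing else was touched, except that 6 blank line(s) were dropped for the 400-line rule. List of the added docstrings: HOME `pub-oswblow-courier/g2/DOCSTRINGS.tsv`.
-/
noncomputable section
open Complex Set Filter
open scoped Topology
open Literature.Analysis.FluidPDE.OkamotoSakajoWunsch2008
namespace Summit.NavierStokesRegularity.OSWSelfSimilar.Mechanism.EffectiveFloor
open Summit.NavierStokesRegularity.OSWSelfSimilar.Mechanism.GlobalBranch Summit.NavierStokesRegularity.OSWSelfSimilar.Mechanism.ChordSlope Summit.NavierStokesRegularity.OSWSelfSimilar.Mechanism.SourceDefect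
open Summit.NavierStokesRegularity.OSWSelfSimilar.Mechanism.FirstCritFloor
open Set
/-- LEMMA 33.3 (iii), THE FENCE (Mathlib's `image_le_of_deriv_right_lt_deriv_boundary` with a constant barrier): if `F` is
continuous on `[x₀, c]`, right-differentiable on `[x₀, c)` with derivative `F′`, `F(x₀) ≤ s`, and `F′(x) < 0` wherever
`F(x) = s` on `[x₀, c)`, then `F ≤ s` on `[x₀, c]`. -/
theorem fence (F F' : ℝ → ℝ) (x₀ c s : ℝ) (hF : ContinuousOn F (Icc x₀ c))
    (hF' : ∀ x ∈ Ico x₀ c, HasDerivWithinAt F (F' x) (Ici x) x) (h0 : F x₀ ≤ s)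
    (hneg : ∀ x ∈ Ico x₀ c, F x = s → F' x < 0) : ∀ x ∈ Icc x₀ c, F x ≤ s := by
  intro x hx
  have key := image_le_of_deriv_right_lt_deriv_boundary hF hF' (B := fun _ => s) (B' := fun _ => 0) h0
    (fun y => hasDerivAt_const y s) (fun y hy hys => by simpa using hneg y hy hys)
  simpa using key hx

/-! ### LEMMA 33.4: the sink strain from the body height -/

/-- LEMMA 33.4, the algebra: `π·B₀ ≤ π(A₀ + B₀)X²/8 + s·(log 2 + π/2 + 1)` with `0 < X ≤ 1/2`
⇒ `B₀ ≤ 0.13·A₀·X² + 1.08·s`. -/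
theorem sink_split_alg (A0 B0 X s : ℝ) (hA : 0 ≤ A0) (hB : 0 ≤ B0) (hs : 0 ≤ s) (hX0 : 0 < X) (hX : X ≤ 1 / 2)
    (hsplit : Real.pi * B0 ≤ Real.pi * (A0 + B0) * X ^ 2 / 8 + s * (Real.log 2 + Real.pi / 2 + 1)) :
    B0 ≤ 0.13 * A0 * X ^ 2 + 1.08 * s := by
  have hπ1 := Real.pi_gt_d2
  have hπ2 := Real.pi_lt_d2
  have hl2 := Real.log_two_lt_d9
  have hπpos : 0 < Real.pi := Real.pi_pos
  have hX2 : X ^ 2 ≤ 1 / 4 := by nlinarith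
  have hBX : Real.pi * B0 * X ^ 2 / 8 ≤ Real.pi * B0 * (1 / 32) := by
    nlinarith [mul_nonneg (mul_nonneg hπpos.le hB) (by linarith : (0:ℝ) ≤ 1 / 4 - X ^ 2)]
  have h1 : Real.pi * B0 * (31 / 32) ≤ Real.pi * A0 * X ^ 2 / 8 + s * (Real.log 2 + Real.pi / 2 + 1) := by
    have e : Real.pi * (A0 + B0) * X ^ 2 / 8 = Real.pi * A0 * X ^ 2 / 8 + Real.pi * B0 * X ^ 2 / 8 := by ring
    linarith [e, hBX, hsplit]
  have h2 : s * (Real.log 2 + Real.pi / 2 + 1) ≤ s * 3.2682 :=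
    mul_le_mul_of_nonneg_left (by linarith) hs
  have e1 : Real.pi * A0 * X ^ 2 / 8 ≤ Real.pi * (0.13 * A0 * X ^ 2) * (31 / 32) := by
    nlinarith [mul_nonneg hπpos.le (mul_nonneg hA (sq_nonneg X))]
  have e2 : s * 3.2682 ≤ Real.pi * (1.08 * s) * (31 / 32) := by
    nlinarith [mul_nonneg hs (by linarith : (0:ℝ) ≤ Real.pi - 3.14)]
  have hπB : Real.pi * B0 * (31 / 32) ≤ Real.pi * (0.13 * A0 * X ^ 2 + 1.08 * s) * (31 / 32) := by
    nlinarith [h1, h2, e1, e2]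
  by_contra hcon
  push Not at hcon
  nlinarith [mul_pos (mul_pos hπpos (sub_pos.2 hcon)) (by norm_num : (0:ℝ) < 31 / 32), hπB]

/-- THEOREM M37 (ii): with `s₁ ≤ 13.3/J`, `B₀ ≤ 0.13·A₀·X² + 14.4/J`. -/
theorem M37_sink_alg (A0 B0 X s₁ : ℝ) (J : ℕ) (hJ : 0 < J) (h : B0 ≤ 0.13 * A0 * X ^ 2 + 1.08 * s₁)
    (hs : s₁ ≤ 13.3 / J) : B0 ≤ 0.13 * A0 * X ^ 2 + 14.4 / J := by
  have hJr : (0:ℝ) < J := by exact_mod_cast hJ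
  have h1 : 1.08 * s₁ ≤ 14.4 / J := by
    calc 1.08 * s₁ ≤ 1.08 * (13.3 / J) := by nlinarith
      _ = 14.364 / J := by ring
      _ ≤ 14.4 / J := div_le_div_of_nonneg_right (by norm_num) hJr.le
  linarith

/-! ### THEOREM M38: the two cases and the explicit data -/

/-- `L_b ≥ L_ε`: for `a > 3/5` and `ℓ ≥ 0`, `1 + (4/a)·ℓ ≤ 1 + (20/3)·ℓ`. -/
theorem L_window_alg (a ℓ : ℝ) (ha : 3 / 5 < a) (hℓ : 0 ≤ ℓ) : 1 + 4 / a * ℓ ≤ 1 + 20 / 3 * ℓ := by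
  have ha0 : 0 < a := by linarith
  have h : 4 / a ≤ 20 / 3 := by rw [div_le_div_iff₀ ha0 (by norm_num)]; linarith
  nlinarith

/-- `ε_b·L_b ≤ Q_b`: for `0 < Q ≤ 2⁻¹⁹`, `Q³·(1 + (20/3)·log(π/(2Q³))) ≤ Q` (so `X = 2^J·L_b·ε_b ≤ 2^J·Q_b = X_b`). -/
theorem epsL_le_Q (Q : ℝ) (hQ : 0 < Q) (hQ19 : Q ≤ 1 / 524288) :
    Q ^ 3 * (1 + 20 / 3 * Real.log (Real.pi / (2 * Q ^ 3))) ≤ Q := by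
  have hπ := Real.pi_lt_d2
  have hQ0 : Q ≠ 0 := ne_of_gt hQ
  have hQ3 : 0 < Q ^ 3 := by positivity
  have hsplit : Real.log (Real.pi / (2 * Q ^ 3)) = Real.log (Real.pi / 2) + Real.log ((Q ^ 3)⁻¹) := by
    rw [← Real.log_mul (by positivity) (by positivity)]
    congr 1
    field_simp
  have hlq : Real.log ((Q ^ 3)⁻¹) = 3 * Real.log (Q⁻¹) := by
    rw [Real.log_inv, Real.log_pow, Real.log_inv]; push_cast; ring
  have hl1 : Real.log (Real.pi / 2) ≤ 1 := by
    have := Real.log_le_sub_one_of_pos (show (0:ℝ) < Real.pi / 2 by positivity); linarith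
  have hl3 : Real.log (Q⁻¹) ≤ Q⁻¹ - 1 := Real.log_le_sub_one_of_pos (by positivity)
  rw [hsplit, hlq]
  have hmono : Q ^ 3 * (1 + 20 / 3 * (Real.log (Real.pi / 2) + 3 * Real.log Q⁻¹))
      ≤ Q ^ 3 * (1 + 20 / 3 * (1 + 3 * (Q⁻¹ - 1))) := by
    apply mul_le_mul_of_nonneg_left _ hQ3.le
    linarith
  have e2 : Q ^ 3 * (1 + 20 / 3 * (1 + 3 * (Q⁻¹ - 1))) = 20 * Q ^ 2 - 37 / 3 * Q ^ 3 := by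
    field_simp; ring
  have hQ2 : Q ^ 2 ≤ Q * (1 / 524288) := by nlinarith
  nlinarith [hmono, e2, hQ2, hQ3]

/-- THEOREM M38, CASE 2 cannot occur: `X² ≤ b/A₂`, `J ≥ 58/b` and THEOREM M37's bound contradict `B₀ ≥ b`. -/
theorem case2_contra (A2 B0 X b : ℝ) (J : ℕ) (hb : 0 < b) (hA : 0 < A2) (hJ : 58 / b ≤ (J:ℝ))
    (hX : X ^ 2 ≤ b / A2) (hM37 : B0 ≤ 0.13 * A2 * X ^ 2 + 14.4 / J) (hB : b ≤ B0) : False := by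
  have hA0 : A2 ≠ 0 := ne_of_gt hA
  have hJpos : (0:ℝ) < J := lt_of_lt_of_le (by positivity) hJ
  have h1 : 0.13 * A2 * X ^ 2 ≤ 0.13 * b := by
    have := mul_le_mul_of_nonneg_left hX (by positivity : (0:ℝ) ≤ 0.13 * A2)
    calc 0.13 * A2 * X ^ 2 ≤ 0.13 * A2 * (b / A2) := this
      _ = 0.13 * b := by field_simp
  have h2 : 14.4 / (J:ℝ) ≤ 14.4 / (58 / b) := div_le_div_of_nonneg_left (by norm_num) (by positivity) hJ
  have h3 : 14.4 / (58 / b) = 14.4 * b / 58 := by field_simp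
  linarith [h1, h2, h3]

/-- THEOREM M38, CASE 1: the octave count `x_m > ε·2^{−(N+1)}` with `N ≤ N_max` and NO NEEDLE
`C₀·x_m ≤ T·(π/2)·A₂` (THEOREM M34 + (22.9)) give `C₀ < π·T·A₂·2^{N_max}/ε`. -/
theorem case1_alg (C0 xm ε T A2 Nmax : ℝ) (N : ℕ) (hε : 0 < ε) (hxm : 0 < xm) (hT : 0 < T) (hA : 0 < A2)
    (hfloor : ε / 2 ^ (N + 1) < xm) (hNN : C0 * xm ≤ T * (Real.pi / 2) * A2) (hN : (N:ℝ) ≤ Nmax) :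
    C0 < Real.pi * T * A2 * (2:ℝ) ^ Nmax / ε := by
  have hπ : 0 < Real.pi := Real.pi_pos
  have h2N : (0:ℝ) < 2 ^ (N + 1) := by positivity
  have hC0 : C0 ≤ T * (Real.pi / 2) * A2 / xm := by rw [le_div_iff₀ hxm]; exact hNN
  have hinv : 1 / xm < 2 ^ (N + 1) / ε := by
    rw [div_lt_div_iff₀ hxm hε]
    rw [div_lt_iff₀ h2N] at hfloor
    linarith
  have hpow : (2:ℝ) ^ (N + 1) = 2 * (2:ℝ) ^ (N:ℝ) := by
    rw [pow_succ, Real.rpow_natCast]; ring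
  have hmono : (2:ℝ) ^ (N:ℝ) ≤ (2:ℝ) ^ Nmax := Real.rpow_le_rpow_of_exponent_le (by norm_num) hN
  have hK : 0 < T * (Real.pi / 2) * A2 := by positivity
  calc C0 ≤ T * (Real.pi / 2) * A2 / xm := hC0
    _ = T * (Real.pi / 2) * A2 * (1 / xm) := by ring
    _ < T * (Real.pi / 2) * A2 * (2 ^ (N + 1) / ε) := mul_lt_mul_of_pos_left hinv hK
    _ = Real.pi * T * A2 * (2:ℝ) ^ (N:ℝ) / ε := by rw [hpow]; ring
    _ ≤ Real.pi * T * A2 * (2:ℝ) ^ Nmax / ε := by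
        apply div_le_div_of_nonneg_right _ hε.le
        exact mul_le_mul_of_nonneg_left hmono (by positivity)

/-! ### LEMMA 33.8: the endpoints are strict -/

/-- LEMMA 33.8 (a), the pointwise minorant: `u ≤ C₀` gives `2C₀ − u·(1 + cos y) ≥ C₀·(1 − cos y)`, so the integrand of
`|h″(0)| = (1/π)∫₀^π (2C₀ − G)/(1 − cos y) dy` is at least `C₀`. -/
theorem source_curv_integrand (C0 u c : ℝ) (hu : u ≤ C0) (hc2 : -1 ≤ c) :
    C0 * (1 - c) ≤ 2 * C0 - u * (1 + c) := by
  nlinarith [mul_nonneg (sub_nonneg.2 hu) (by linarith : (0:ℝ) ≤ 1 + c)]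

/-- LEMMA 33.8 (b): `c₂ = (1 − a/3)·h₂ + a·A₀/3` with `h₂ = h″(0)/2 ≤ −C₀/2` and `C₀ ≥ A₀ = 1/(1 − a)` give `c₂ ≤ −1/2`
and `u″(0) = C₀·c₂/(a·A₀) ≤ −C₀/(2a·A₀) < 0`. -/
theorem source_endpoint_strict (a A0 C0 h2 c2 : ℝ) (ha : 0 < a) (ha1 : a < 1) (hA : A0 = 1 / (1 - a))
    (hC : A0 ≤ C0) (hh2 : h2 ≤ -C0 / 2) (hc2 : c2 = (1 - a / 3) * h2 + a * A0 / 3) :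
    c2 ≤ -1 / 2 ∧ C0 * c2 / (a * A0) ≤ -C0 / (2 * a * A0) := by
  have h1a : 0 < 1 - a := by linarith
  have hA0 : 0 < A0 := by rw [hA]; positivity
  have hAa : A0 * (1 - a) = 1 := by rw [hA]; field_simp
  have hC0 : 0 < C0 := lt_of_lt_of_le hA0 hC
  have hc : c2 ≤ -1 / 2 := by
    rw [hc2]
    have e1 : (1 - a / 3) * h2 ≤ (1 - a / 3) * (-C0 / 2) := mul_le_mul_of_nonneg_left hh2 (by linarith)
    have e2 : (1 - a / 3) * (-C0 / 2) ≤ (1 - a / 3) * (-A0 / 2) := by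
      apply mul_le_mul_of_nonneg_left _ (by linarith); linarith
    nlinarith [e1, e2, hAa]
  refine ⟨hc, ?_⟩
  rw [div_le_div_iff₀ (by positivity) (by positivity)]
  nlinarith [mul_pos (mul_pos hC0 ha) hA0, hc]

/-- LEMMA 33.8 (c): `χ(π⁻) = h(π) − 1 − a·lim g·cot = −B₀ − 1 + a·B₀ = −(1 + (1 − a)B₀) ≤ −1`. -/
theorem sink_endpoint_strict (a B0 : ℝ) (ha1 : a ≤ 1) (hB : 0 ≤ B0) :
    -B0 - 1 - a * (-B0) = -(1 + (1 - a) * B0) ∧ -(1 + (1 - a) * B0) ≤ -1 := by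
  constructor
  · ring
  · nlinarith [mul_nonneg (by linarith : (0:ℝ) ≤ 1 - a) hB]

/-! ### The explicit data of THEOREM M38 (definitions; `T` = THEOREM M34's `T(3/5)`, a parameter here) -/

/-- `N_max(θ, A₂)` of THEOREM 32.5, STEP 3. -/
def octaveCountBound (θ A2 : ℝ) : ℝ :=
  (31 * A2 ^ 2 / θ + 1) * (1 + 12 * A2 ^ 2 / θ) + 2 * A2 / θ * Real.log (84 * A2)

/-- `J_b = max(18, ⌈58/b⌉)`. -/
def effJ (b : ℝ) : ℕ := max 18 ⌈58 / b⌉₊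

/-- `X_b = min(1/2, (b/A₂)^{1/2})`. -/
def effX (A2 b : ℝ) : ℝ := min (1 / 2) (Real.sqrt (b / A2))

/-- `Q_b = X_b·2^{−J_b}`. -/
def effQ (A2 b : ℝ) : ℝ := effX A2 b / 2 ^ effJ b

/-- `ε_b = Q_b³`. -/
def effEps (A2 b : ℝ) : ℝ := effQ A2 b ^ 3

/-- `L_b = 1 + (20/3)·log(π/(2ε_b))`. -/
def effL (A2 b : ℝ) : ℝ := 1 + 20 / 3 * Real.log (Real.pi / (2 * effEps A2 b))

/-- `θ_b = 1/(2L_b)`. -/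
def effTheta (A2 b : ℝ) : ℝ := 1 / (2 * effL A2 b)

/-- `Ψ^eff(T; A₂, b) = π·T·A₂·2^{N_max(θ_b, A₂)}/ε_b`. -/
def psiEffOf (T A2 b : ℝ) : ℝ :=
  Real.pi * T * A2 * (2:ℝ) ^ octaveCountBound (effTheta A2 b) A2 / effEps A2 b

/-- `18 ≤ J_b` (`effJ b = max(18, ⌈58/b⌉)`). -/
theorem effJ_ge (b : ℝ) : 18 ≤ effJ b := le_max_left _ _

/-- `58/b ≤ J_b` (`effJ b = max(18, ⌈58/b⌉)`). -/
theorem effJ_ge' (b : ℝ) : 58 / b ≤ (effJ b : ℝ) := by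
  have h1 : 58 / b ≤ (⌈58 / b⌉₊ : ℝ) := Nat.le_ceil _
  have h2 : (⌈58 / b⌉₊ : ℝ) ≤ (effJ b : ℝ) := by
    unfold effJ; exact_mod_cast le_max_right _ _
  linarith

/-- `X_b ≤ 1/2` (`effX A₂ b = min(1/2, √(b/A₂))`). -/
theorem effX_le_half (A2 b : ℝ) : effX A2 b ≤ 1 / 2 := min_le_left _ _

/-- `0 < X_b` for `A₂, b > 0`. -/
theorem effX_pos (A2 b : ℝ) (hA : 0 < A2) (hb : 0 < b) : 0 < effX A2 b :=
  lt_min (by norm_num) (Real.sqrt_pos.2 (by positivity))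

/-- `X_b² ≤ b/A₂` for `A₂, b > 0`. -/
theorem effX_sq_le (A2 b : ℝ) (hA : 0 < A2) (hb : 0 < b) : effX A2 b ^ 2 ≤ b / A2 := by
  have h0 : 0 ≤ effX A2 b := (effX_pos A2 b hA hb).le
  have h1 : effX A2 b ≤ Real.sqrt (b / A2) := min_le_right _ _
  calc effX A2 b ^ 2 ≤ Real.sqrt (b / A2) ^ 2 := by gcongr
    _ = b / A2 := Real.sq_sqrt (by positivity)

/-- `0 < Q_b` for `A₂, b > 0` (`Q_b = X_b·2^{−J_b}`). -/
theorem effQ_pos (A2 b : ℝ) (hA : 0 < A2) (hb : 0 < b) : 0 < effQ A2 b := by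
  unfold effQ; exact div_pos (effX_pos A2 b hA hb) (by positivity)

/-- `Q_b ≤ 1/524288` (`= 2^{−19}`, from `X_b ≤ 1/2` and `J_b ≥ 18`). -/
theorem effQ_le (A2 b : ℝ) : effQ A2 b ≤ 1 / 524288 := by
  unfold effQ
  have hJ := effJ_ge b
  have h2 : (262144:ℝ) ≤ 2 ^ effJ b := by
    have := pow_le_pow_right₀ (by norm_num : (1:ℝ) ≤ 2) hJ
    norm_num at this
    exact this
  have hX := effX_le_half A2 b
  rw [div_le_div_iff₀ (by positivity) (by norm_num)]
  linarith

/-- The scale `X = 2^{J_b}·L_b·ε_b` used in CASE 2 is at most `X_b ≤ 1/2`. -/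
theorem effScale_le (A2 b : ℝ) (hA : 0 < A2) (hb : 0 < b) :
    2 ^ effJ b * (effL A2 b * effEps A2 b) ≤ effX A2 b := by
  have hQ := effQ_pos A2 b hA hb
  have hQ' := effQ_le A2 b
  have key : effEps A2 b * effL A2 b ≤ effQ A2 b := by
    unfold effL effEps
    exact epsL_le_Q (effQ A2 b) hQ hQ'
  have e : 2 ^ effJ b * effQ A2 b = effX A2 b := by
    unfold effQ; field_simp
  calc 2 ^ effJ b * (effL A2 b * effEps A2 b) ≤ 2 ^ effJ b * effQ A2 b := by
        rw [mul_comm (effL A2 b)]; exact mul_le_mul_of_nonneg_left key (by positivity)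
    _ = effX A2 b := e

/-- `0 < Ψ^eff(T; A₂, b)` for `T, A₂, b > 0`. -/
theorem psiEffOf_pos (T A2 b : ℝ) (hT : 0 < T) (hA : 0 < A2) (hb : 0 < b) : 0 < psiEffOf T A2 b := by
  unfold psiEffOf effEps
  have := effQ_pos A2 b hA hb
  positivity

/-! ### §33 typed: the explicit constant `Ψ_𝒮^eff`, THEOREM M38 and COROLLARY 33.7 as named statements, and the
kernel-checked spines (M38 ⇒ M36 with `C := Ψ_𝒮^eff(a₂,b)`; M38 + LEMMA 32.3 ⇒ the EFFECTIVE floor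
`x_m ≥ ξ^eff(a₂,b) = 3/(40·max(Ψ^eff,1))` ⇒ the floor of THEOREM M36).  THEOREM M37 (quantitative rigidity under small
unspent budget) and LEMMA 33.8 (strict endpoints) involve the budget function `R = A₀ − B`, the octave scale and `u″(0)`,
which are not in the typed vocabulary of this module: they are recorded in MECHANISM.md §33 and their algebra is
kernel-checked above. -/

/-- **THE EXPLICIT CONSTANT OF THEOREM M38:** `Ψ_𝒮^eff(a₂, b) = π·T(3/5)·A₂·2^{N_max(θ_b, A₂)}/ε_b` with
`A₂ = 1/(1 − a₂)`, `T = noNeedleT` (THEOREM M34's constant, taken at `a = 3/5` where it is largest on the window),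
`N_max = octaveCountBound` (THEOREM 32.5, STEP 3) and the data `J_b = max(18, ⌈58/b⌉)`, `X_b = min(1/2, √(b/A₂))`,
`Q_b = X_b·2^{−J_b}`, `ε_b = Q_b³`, `L_b = 1 + (20/3)·log(π/(2ε_b))`, `θ_b = 1/(2L_b)` of THEOREM 33.6 (`effJ`, `effX`,
`effQ`, `effEps`, `effL`, `effTheta`).  ASTRONOMICALLY LARGE (floats F33: `log₁₀ log₁₀ Ψ^eff ≈ 13.2` at
`(a₂, b) = (0.7, 0.05)`) — logical effectivity only; no realistic size is claimed. -/
def psiEff (a₂ b : ℝ) : ℝ := psiEffOf (noNeedleT (3 / 5)) (1 / (1 - a₂)) b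

/-- `0 < Ψ_𝒮^eff(a₂, b)` for `a₂ < 1`, `b > 0`. -/
theorem psiEff_pos (a₂ b : ℝ) (ha : a₂ < 1) (hb : 0 < b) : 0 < psiEff a₂ b := by
  have h1 : 0 < 1 - a₂ := by linarith
  exact psiEffOf_pos _ _ _ (noNeedleT_pos _) (by positivity) hb

/-- **THEOREM 33.6 = THEOREM M38, typed (PROVED pen-and-paper, MECHANISM.md §33.6; EFFECTIVE M36 — QUESTION 32.8 (b):
YES):** on `𝒮 ∩ {3/5 < a ≤ a₂ < 1, |Hf(π)| ≥ b > 0}` (profiles with a first critical point) the chord slope is bounded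
by the EXPLICIT constant `Ψ_𝒮^eff(a₂, b)` (`psiEff`).  Proof in MECHANISM.md §33.6: with `ε = ε_b` either the unspent
budget `R(ε_b) ≥ 1 + 2θ_b` (CASE 1: THEOREM 32.5 STEP 3 verbatim bounds the number of octaves between `x_m` and `ε_b`,
then NO NEEDLE (M34) and (22.9)), or `R(ε_b) < 1 + 1/L_b` (CASE 2: THEOREM M37 forces `|Hf(π)| ≤ 0.13·X_b²·A₂ + 14.4/J_b
< b`, impossible).  Kernel-checked pieces: THEOREM M37's algebra (`strain_beyond_alg`, `delta_prime_alg`,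
`light_octave_exists`, `tan_le_on_quarter`, `light_height_alg`, `transport_integrand_le`, `exponent_alg`,
`rpow_le_exp_one`, `body_height_alg`, `tail_slope_neg`, `fence` (= Mathlib's `image_le_of_deriv_right_lt_deriv_boundary`
with a constant barrier), `sink_split_alg`, `M37_sink_alg`) and THEOREM M38's (`L_window_alg`, `epsL_le_Q`,
`effScale_le`: `2^{J_b}·L_b·ε_b ≤ X_b`, `effJ_ge`, `effJ_ge'`, `effX_sq_le`, `effQ_le`, `case1_alg`, `case2_contra`).
NOT formalised: the integral estimates ((32.1), (32.2), the split of `B₀` in LEMMA 33.4), the transport ODE (T1) on the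
body, THEOREM 32.5 STEP 3 as an inequality between integrals — i.e. the analysis of §§32–33. -/
def EffectiveSlopeBoundSStatement (NegP : ℝ → (ℤ → ℂ) → Prop) : Prop :=
  ∀ a₂ b : ℝ, 3 / 5 < a₂ → a₂ < 1 → 0 < b → ∀ (a : ℝ) (c : ℤ → ℂ), NegP a c → (1 - a) * HfR c 0 = 1 →
    3 / 5 < a → a ≤ a₂ → b ≤ -HfR c Real.pi → InS c → (∃ xm : ℝ, IsFirstCrit c xm) → ChordBound c (psiEff a₂ b)

/-- KERNEL-CHECKED: THEOREM M38 contains THEOREM M36 ((29.10) on `𝒮`, now with the witness `C := Ψ_𝒮^eff(a₂,b)`). -/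
theorem slopeBoundS_of_effective {NegP : ℝ → (ℤ → ℂ) → Prop} (h : EffectiveSlopeBoundSStatement NegP) :
    SlopeBoundSStatement NegP :=
  fun a₂ b ha₂ ha₂' hb => ⟨psiEff a₂ b, h a₂ b ha₂ ha₂' hb⟩

/-- **COROLLARY 33.7: THE EFFECTIVE FLOOR** `ξ^eff(a₂, b) = 3/(40·max(Ψ_𝒮^eff(a₂,b), 1))` for the first critical point. -/
def xiEff (a₂ b : ℝ) : ℝ := 3 / (40 * max (psiEff a₂ b) 1)

/-- The effective floor is positive: `0 < ξ^eff(a₂, b) = 3/(40·max(Ψ_𝒮^eff(a₂,b), 1))`. -/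
theorem xiEff_pos (a₂ b : ℝ) : 0 < xiEff a₂ b := by unfold xiEff; positivity

/-- COROLLARY 33.7, typed: on the window, the first critical point satisfies `x_m ≥ ξ^eff(a₂, b)` (EXPLICIT). -/
def EffectiveFirstCritFloorStatement (NegP : ℝ → (ℤ → ℂ) → Prop) : Prop :=
  ∀ a₂ b : ℝ, 3 / 5 < a₂ → a₂ < 1 → 0 < b → ∀ (a : ℝ) (c : ℤ → ℂ), NegP a c → (1 - a) * HfR c 0 = 1 →
    3 / 5 < a → a ≤ a₂ → b ≤ -HfR c Real.pi → InS c → ∀ xm : ℝ, IsFirstCrit c xm → xiEff a₂ b ≤ xm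

/-- KERNEL-CHECKED (COROLLARY 33.7): THEOREM M38 and THE TANGENT REACHES HEIGHT (LEMMA 32.3: `C·x_m ≥ a/8` for every
chord-slope constant `C`) give the effective floor. -/
theorem effectiveFloor_of_effective {NegP : ℝ → (ℤ → ℂ) → Prop} (h : EffectiveSlopeBoundSStatement NegP)
    (hT : TangentHeightStatement NegP) : EffectiveFirstCritFloorStatement NegP := by
  intro a₂ b ha₂ ha₂' hb a c hN hq ha haa hB hS xm hxm
  have hcb : ChordBound c (psiEff a₂ b) := h a₂ b ha₂ ha₂' hb a c hN hq ha haa hB hS ⟨xm, hxm⟩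
  have hk : a / 8 ≤ psiEff a₂ b * xm := (hT a c hN hq ha (lt_of_le_of_lt haa ha₂') hS xm hxm).2 _ hcb
  have hxm0 : 0 < xm := hxm.1
  have hmax : psiEff a₂ b * xm ≤ max (psiEff a₂ b) 1 * xm :=
    mul_le_mul_of_nonneg_right (le_max_left _ _) hxm0.le
  have hm0 : 0 < max (psiEff a₂ b) 1 := lt_of_lt_of_le one_pos (le_max_right _ _)
  unfold xiEff
  rw [div_le_iff₀ (by positivity)]
  nlinarith [hk, hmax, ha]

/-- KERNEL-CHECKED: the effective floor is in particular a floor (THEOREM M36's `FirstCritFloorConjecture`, with the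
explicit witness `ξ := ξ^eff(a₂, b)`). -/
theorem floor_of_effectiveFloor {NegP : ℝ → (ℤ → ℂ) → Prop} (h : EffectiveFirstCritFloorStatement NegP) :
    FirstCritFloorConjecture NegP :=
  fun a₂ b ha₂ ha₂' hb => ⟨xiEff a₂ b, xiEff_pos a₂ b, h a₂ b ha₂ ha₂' hb⟩

/-- **The v27 bundle of this module's §33 block:** the v26 bundle ∧ THEOREM M38 — typed shadows, parametric in `NegP`,
all PROVED pen-and-paper. -/
def EffectiveFloorBundle (NegP : ℝ → (ℤ → ℂ) → Prop) : Prop :=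
  FirstCritFloorBundle NegP ∧ EffectiveSlopeBoundSStatement NegP

/-- **v27 headline reduction (kernel-checked):** the v27 bundle gives (29.10) on `𝒮` with the explicit constant, the
EFFECTIVE floor for the first critical point (COROLLARY 33.7), hence THEOREM M36's floor with an explicit witness; and,
with the v24 bundle, every rung on every eventually-monotone branch tail with `a ≤ a₂ < 1` (COROLLARY 32.6 (a), via
`ladder_of_v26`). -/
theorem ladder_of_v27 {NegP : ℝ → (ℤ → ℂ) → Prop} (h24 : ChordSlopeBundle NegP) (h27 : EffectiveFloorBundle NegP) :
    SlopeBoundSStatement NegP ∧ EffectiveFirstCritFloorStatement NegP ∧ FirstCritFloorConjecture NegP ∧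
    (∀ β : NNReal, 0 < β → β < 1 → ∃ (aσ : ℝ → ℝ) (cσ : ℝ → ℤ → ℂ), BranchFamily NegP β aσ cσ ∧
      ChordSlopeDiverges aσ cσ ∧
      ∀ a₂ σ₁ : ℝ, 3 / 5 < a₂ → a₂ < 1 →
        (∀ σ : ℝ, σ₁ < σ → 0 < σ → aσ σ ≤ a₂ ∧ InS (cσ σ) ∧ ∃ xm : ℝ, IsFirstCrit (cσ σ) xm) →
        ∀ n : ℕ, ∃ σ : ℝ, 0 < σ ∧ NegP (aσ σ) (cσ σ) ∧ (1 - aσ σ) * HfR (cσ σ) 0 = 1 ∧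
          HfR (cσ σ) Real.pi = -(1 / (aσ σ * (2 * (n : ℝ) + 3) - 1))) := by
  have hE : EffectiveFirstCritFloorStatement NegP := effectiveFloor_of_effective h27.2 h27.1.2.1
  exact ⟨slopeBoundS_of_effective h27.2, hE, floor_of_effectiveFloor hE, (ladder_of_v26 h24 h27.1).1⟩

end Summit.NavierStokesRegularity.OSWSelfSimilar.Mechanism.EffectiveFloor

/-! ## §34 (v28): the source is uniformly smooth; Chen's arc lies strictly inside `𝒮` — (34.1)–(34.3) (the defect
along the analytic family), LEMMA 34.1 (Privalov, pseudo-local), LEMMA 34.2 (uniform smoothness at the source: the Fuchsian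
bootstrap), LEMMA 34.3 (the transport defect at the De Gregorio end), THEOREM M39 (Chen's arc strictly in `𝒮₁ ⊂ 𝒮`, both
layers; the chord slope analytic at `a = 1`), COROLLARY 34.5 (the exit lemma unconditionally; the exit parameter `σ_𝒮`),
REMARK 34.6, QUESTION 34.7 (MECHANISM.md v28 §34).
1-D model (gCLM/OSW), computer-assisted; not Euler/NS. -/

namespace Summit.NavierStokesRegularity.OSWSelfSimilar.Mechanism.ChenArcShape

open Summit.NavierStokesRegularity.OSWSelfSimilar.Mechanism.GlobalBranch Summit.NavierStokesRegularity.OSWSelfSimilar.Mechanism.ChordSlope Summit.NavierStokesRegularity.OSWSelfSimilar.Mechanism.SourceDefect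
open Summit.NavierStokesRegularity.OSWSelfSimilar.Mechanism.FirstCritFloor Summit.NavierStokesRegularity.OSWSelfSimilar.Mechanism.EffectiveFloor
open Set

/-! ### (34.2): `χ⁰ = −sin x · ψ′` from the corrector equation `𝓛φ⁰ = sin x (cos x − 1)` -/
/-- (34.2): at a point with `s = sin x ≠ 0`, `c = cos x`, the corrector equation
`−s φ′ + c φ + c Γ − s E = s (c − 1)` (`E = Hφ⁰`, `Γ = ∫₀ˣ E`) turns the limiting transport defect
`χ⁰ = (c − 1) + E − Γ·c/s` into `−s·ψ′`, `ψ′ = (φ/s)′ = (φ′ s − φ c)/s²`. -/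
theorem chi0_identity (s c φ φ' Γ E : ℝ) (hs : s ≠ 0) (h : -s * φ' + c * φ + c * Γ - s * E = s * (c - 1)) :
    (c - 1) + E - Γ * (c / s) = -(s * ((φ' * s - φ * c) / s ^ 2)) := by
  have h1 : (c - 1) + E - Γ * (c / s) = (s * (c - 1) + s * E - Γ * c) / s := by field_simp
  have h2 : -(s * ((φ' * s - φ * c) / s ^ 2)) = (-(φ' * s - φ * c)) / s := by field_simp
  rw [h1, h2]
  congr 1
  linarith

/-! ### (34.2′): the envelope `χ⁰ ≤ −sin²(x/2) − x sin x / 2` -/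
/-- `sin x · (½ tan(x/2)) = sin²(x/2)` whenever `cos(x/2) ≠ 0`. -/
theorem half_sin_mul_tan_half (x : ℝ) (hc : Real.cos (x / 2) ≠ 0) :
    Real.sin x * (Real.tan (x / 2) / 2) = Real.sin (x / 2) ^ 2 := by
  have hx : Real.sin x = 2 * Real.sin (x / 2) * Real.cos (x / 2) := by
    have e : x = 2 * (x / 2) := by ring
    conv_lhs => rw [e]
    exact Real.sin_two_mul (x / 2)
  rw [hx, Real.tan_eq_sin_div_cos]
  field_simp
end Summit.NavierStokesRegularity.OSWSelfSimilar.Mechanism.ChenArcShape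
end
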